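import Mathlib.Analysis.Normed.Module.Alternating.Uncurry.Fin
import Mathlib.Analysis.Normed.Operator.Mul
import HarnessLib

/-!
# Wedge with a `1`-form and interior products of continuous alternating maps (CAR identities)

For a continuous linear functional `θ : E →L[𝕜] 𝕜'` (a constant `1`-form with values in a normed
field extension `𝕜'` of `𝕜`, e.g. `𝕜 = ℝ`, `𝕜' = ℂ`) and a continuous alternating map
`η : E [⋀^Fin n]→L[𝕜] F` (`F` a normed `𝕜'`-space) we define

* `wedgeOne θ η = θ ∧ η : E [⋀^Fin (n+1)]→L[𝕜] F`,
  `(θ ∧ η)(v₀,…,vₙ) = ∑ᵢ (-1)ⁱ θ(vᵢ) η(v₀,…,v̂ᵢ,…,vₙ)`, through Mathlib's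
  `ContinuousAlternatingMap.alternatizeUncurryFin` (the operation underlying `extDeriv`), and use
* Mathlib's interior product `ContinuousAlternatingMap.curryLeft η w = w ⌟ η`,
  `(w ⌟ η)(v₁,…,vₙ) = η(w, v₁, …, vₙ)`,

and prove the **canonical anticommutation relations** of the exterior algebra
(Warner (1983), 2.6 and 2.10–2.11: interior multiplication is an antiderivation; Hörmander
(1973), §2.1 for the forms `dz̄_j ∧ ·`):

* `curryLeft_wedgeOne`: `w ⌟ (θ ∧ η) = θ(w) η - θ ∧ (w ⌟ η)`;
* `wedgeOne_wedgeOne_add_swap`: `θ ∧ (θ' ∧ η) + θ' ∧ (θ ∧ η) = 0` (so `θ ∧ θ ∧ η = 0`);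
* `curryLeft_curryLeft_swap`: `w' ⌟ (w ⌟ η) = -w ⌟ (w' ⌟ η)` (and `w ⌟ w ⌟ η = 0` is
  Mathlib's `curryLeft_same`).

We also package `η ↦ θ ∧ η` and `η ↦ w ⌟ η` as `𝕜'`-linear continuous maps (`wedgeOneL`,
`curryLeftL`). These feed the `DbarFrame` of `(p,q)`-forms
(`Literature/Analysis/Complex/DbarFrame.lean`). Mathlib has the wedge product only in this
uncurried `1 ∧ n` form at this pin; the tree's `ContinuousAlternatingMap.wedge`
(`Literature/NumberTheory/Transcendental/FormsAlgebra.lean`) is the shuffle product with values in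
an algebra and is not used here.

## References

* F. W. Warner, *Foundations of Differentiable Manifolds and Lie Groups* (1983), 2.6, 2.10,
  2.11. [Warner1983]
* L. Hörmander, *An Introduction to Complex Analysis in Several Variables*, 2nd ed. (1973),
  §2.1. [HormanderSCV1973]
-/

noncomputable section

open ContinuousAlternatingMap Function

namespace Literature.LinearAlgebra.Alternating

variable {𝕜 : Type*} [NontriviallyNormedField 𝕜] {𝕜' : Type*} [NormedField 𝕜']
  [NormedAlgebra 𝕜 𝕜'] {E : Type*} [NormedAddCommGroup E] [NormedSpace 𝕜 E]
  {F : Type*} [NormedAddCommGroup F] [NormedSpace 𝕜 F] [NormedSpace 𝕜' F]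
  [IsScalarTower 𝕜 𝕜' F] {n : ℕ}

/-! ### Tuples: removing an entry of `vecCons` -/

omit [NormedAddCommGroup E] [NormedSpace 𝕜 E] in
/-- Removing the head of `vecCons w v` gives `v`. [folklore] -/
theorem removeNth_zero_vecCons {m : ℕ} (w : E) (v : Fin m → E) :
    Fin.removeNth 0 (Matrix.vecCons w v) = v := by
  ext i
  simp [Fin.removeNth]

omit [NormedAddCommGroup E] [NormedSpace 𝕜 E] in
/-- Removing the entry `i+1` of `vecCons w v` is `vecCons w` of removing the entry `i` of `v`.
[folklore] -/
theorem removeNth_succ_vecCons {m : ℕ} (w : E) (v : Fin (m + 1) → E) (i : Fin (m + 1)) :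
    Fin.removeNth i.succ (Matrix.vecCons w v) = Matrix.vecCons w (Fin.removeNth i v) := by
  ext j
  refine Fin.cases ?_ (fun j' => ?_) j
  · simp [Fin.removeNth]
  · simp [Fin.removeNth, Fin.succ_succAbove_succ]

omit [NormedAddCommGroup E] [NormedSpace 𝕜 E] in
/-- Swapping the first two entries: `vecCons w (vecCons w' v) = vecCons w' (vecCons w v) ∘ swap 0 1`.
[folklore] -/
theorem vecCons_vecCons_eq_comp_swap {m : ℕ} (w w' : E) (v : Fin m → E) :
    Matrix.vecCons w (Matrix.vecCons w' v) =
      Matrix.vecCons w' (Matrix.vecCons w v) ∘ Equiv.swap (0 : Fin (m + 2)) 1 := by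
  ext i
  refine Fin.cases ?_ (fun i' => Fin.cases ?_ (fun i'' => ?_) i') i
  · simp
  · simp
  · have h0 : (i''.succ.succ : Fin (m + 2)) ≠ 0 := Fin.succ_ne_zero _
    have h1 : (i''.succ.succ : Fin (m + 2)) ≠ 1 := by
      rw [show (1 : Fin (m + 2)) = (0 : Fin (m + 1)).succ from rfl]
      exact fun h => Fin.succ_ne_zero _ (Fin.succ_injective _ h)
    simp [Equiv.swap_apply_of_ne_of_ne h0 h1]

/-! ### The wedge with a `1`-form -/

/-- **Wedge with a constant `1`-form**: `θ ∧ η = alternatizeUncurryFin (v ↦ θ v • η)`, i.e.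
`(θ ∧ η)(v₀,…,vₙ) = ∑ᵢ (-1)ⁱ θ(vᵢ) η(v₀,…,v̂ᵢ,…,vₙ)` (Warner (1983), 2.6/2.10 with the
alternatization convention of Mathlib's `extDeriv`; Hörmander (1973), §2.1, `dz̄_j ∧ ·`).
[cite: Warner1983, 2.10] -/
def wedgeOne (θ : E →L[𝕜] 𝕜') (η : E [⋀^Fin n]→L[𝕜] F) : E [⋀^Fin (n + 1)]→L[𝕜] F :=
  alternatizeUncurryFin (θ.smulRight η)

/-- The alternating-sum formula for `θ ∧ η`. [cite: Warner1983, 2.10] -/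
theorem wedgeOne_apply (θ : E →L[𝕜] 𝕜') (η : E [⋀^Fin n]→L[𝕜] F) (v : Fin (n + 1) → E) :
    wedgeOne θ η v = ∑ i : Fin (n + 1), (-1) ^ (i : ℕ) • θ (v i) • η (i.removeNth v) := by
  simp [wedgeOne, alternatizeUncurryFin_apply]

/-- `θ ∧ η` is additive in `η`. [folklore] -/
theorem wedgeOne_add (θ : E →L[𝕜] 𝕜') (η₁ η₂ : E [⋀^Fin n]→L[𝕜] F) :
    wedgeOne θ (η₁ + η₂) = wedgeOne θ η₁ + wedgeOne θ η₂ := by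
  ext v
  simp [wedgeOne_apply, Finset.sum_add_distrib]

/-- `θ ∧ η` commutes with the scalars of `𝕜'` in `η`. [folklore] -/
theorem wedgeOne_smul (θ : E →L[𝕜] 𝕜') (c : 𝕜') (η : E [⋀^Fin n]→L[𝕜] F) :
    wedgeOne θ (c • η) = c • wedgeOne θ η := by
  ext v
  simp [wedgeOne_apply, Finset.smul_sum, smul_comm c, smul_smul]

/-- `θ ∧ 0 = 0`. [folklore] -/
@[simp]
theorem wedgeOne_zero (θ : E →L[𝕜] 𝕜') : wedgeOne θ (0 : E [⋀^Fin n]→L[𝕜] F) = 0 := by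
  ext v
  simp [wedgeOne_apply]

/-- `θ ∧ η` is additive in `θ`. [folklore] -/
theorem wedgeOne_add_left (θ₁ θ₂ : E →L[𝕜] 𝕜') (η : E [⋀^Fin n]→L[𝕜] F) :
    wedgeOne (θ₁ + θ₂) η = wedgeOne θ₁ η + wedgeOne θ₂ η := by
  ext v
  simp [wedgeOne_apply, add_smul, Finset.sum_add_distrib]

/-- `θ ∧ η` commutes with the scalars of `𝕜'` in `θ`. [folklore] -/
theorem wedgeOne_smul_left (c : 𝕜') (θ : E →L[𝕜] 𝕜') (η : E [⋀^Fin n]→L[𝕜] F) :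
    wedgeOne (c • θ) η = c • wedgeOne θ η := by
  ext v
  simp [wedgeOne_apply, Finset.smul_sum, smul_smul, smul_comm c, mul_comm c]

/-- Operator-norm bound `‖θ ∧ η‖ ≤ (n+1) ‖θ‖ ‖η‖`. [folklore] -/
theorem norm_wedgeOne_le (θ : E →L[𝕜] 𝕜') (η : E [⋀^Fin n]→L[𝕜] F) :
    ‖wedgeOne θ η‖ ≤ (n + 1) * ‖θ‖ * ‖η‖ := by
  have h1 : ‖θ.smulRight η‖ ≤ ‖θ‖ * ‖η‖ := by
    refine ContinuousLinearMap.opNorm_le_bound _ (by positivity) fun v => ?_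
    rw [ContinuousLinearMap.smulRight_apply]
    calc ‖θ v • η‖ ≤ ‖θ v‖ * ‖η‖ := norm_smul_le (θ v) η
      _ ≤ ‖θ‖ * ‖v‖ * ‖η‖ := by gcongr; exact θ.le_opNorm v
      _ = ‖θ‖ * ‖η‖ * ‖v‖ := by ring
  calc ‖wedgeOne θ η‖ ≤ (n + 1) * ‖θ.smulRight η‖ := norm_alternatizeUncurryFin_le _
    _ ≤ (n + 1) * (‖θ‖ * ‖η‖) := by gcongr
    _ = (n + 1) * ‖θ‖ * ‖η‖ := by ring

/-- **`η ↦ θ ∧ η` as a `𝕜'`-linear continuous operator** (the creation operator `dz̄_j ∧ ·` of the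
`∂̄`-frame). [folklore] -/
def wedgeOneL (θ : E →L[𝕜] 𝕜') : (E [⋀^Fin n]→L[𝕜] F) →L[𝕜'] (E [⋀^Fin (n + 1)]→L[𝕜] F) :=
  LinearMap.mkContinuous
    { toFun := wedgeOne θ
      map_add' := wedgeOne_add θ
      map_smul' := fun c η => wedgeOne_smul θ c η }
    ((n + 1) * ‖θ‖) fun η => by simpa [mul_assoc] using norm_wedgeOne_le θ η

/-- Unfolding of `wedgeOneL`. [folklore] -/
@[simp]
theorem wedgeOneL_apply (θ : E →L[𝕜] 𝕜') (η : E [⋀^Fin n]→L[𝕜] F) : wedgeOneL θ η = wedgeOne θ η :=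
  rfl

/-! ### The interior product as a `𝕜'`-linear operator -/

/-- `w ⌟ (c • η) = c • (w ⌟ η)` for scalars of `𝕜'`. [folklore] -/
theorem curryLeft_smul' (c : 𝕜') (η : E [⋀^Fin (n + 1)]→L[𝕜] F) (w : E) :
    (c • η).curryLeft w = c • η.curryLeft w := by
  ext v
  simp

/-- **`η ↦ w ⌟ η` as a `𝕜'`-linear continuous operator** (towards the annihilation operators
`∂/∂z̄_j ⌟ ·` of the `∂̄`-frame). [folklore] -/
def curryLeftL (w : E) : (E [⋀^Fin (n + 1)]→L[𝕜] F) →L[𝕜'] (E [⋀^Fin n]→L[𝕜] F) :=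
  LinearMap.mkContinuous
    { toFun := fun η => η.curryLeft w
      map_add' := fun η₁ η₂ => by rw [curryLeft_add]; rfl
      map_smul' := fun c η => curryLeft_smul' c η w }
    ‖w‖ fun η =>
      calc ‖η.curryLeft w‖ ≤ ‖η.curryLeft‖ * ‖w‖ := (η.curryLeft).le_opNorm w
        _ = ‖w‖ * ‖η‖ := by rw [norm_curryLeft, mul_comm]

/-- Unfolding of `curryLeftL`. [folklore] -/
@[simp]
theorem curryLeftL_apply (w : E) (η : E [⋀^Fin (n + 1)]→L[𝕜] F) :
    curryLeftL (𝕜' := 𝕜') w η = η.curryLeft w :=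
  rfl

/-! ### The canonical anticommutation relations -/

/-- **Interior product of a wedge with a `1`-form** (Warner (1983), 2.11: `w ⌟` is an
antiderivation): `w ⌟ (θ ∧ η) = θ(w) η - θ ∧ (w ⌟ η)`. [cite: Warner1983, 2.11] -/
theorem curryLeft_wedgeOne (θ : E →L[𝕜] 𝕜') (η : E [⋀^Fin (n + 1)]→L[𝕜] F) (w : E) :
    (wedgeOne θ η).curryLeft w = θ w • η - wedgeOne θ (η.curryLeft w) := by
  ext v
  rw [curryLeft_apply_apply, wedgeOne_apply, Fin.sum_univ_succ]
  simp only [Fin.val_zero, pow_zero, one_smul, Matrix.cons_val_zero, removeNth_zero_vecCons,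
    Matrix.cons_val_succ, Fin.val_succ, pow_succ, mul_neg_one, neg_smul, Finset.sum_neg_distrib,
    removeNth_succ_vecCons, ContinuousAlternatingMap.sub_apply,
    ContinuousAlternatingMap.smul_apply, wedgeOne_apply, curryLeft_apply_apply]
  abel

/-- In degree `0`: `w ⌟ (θ ∧ η) = θ(w) η` for a `0`-form `η`. [cite: Warner1983, 2.11] -/
theorem curryLeft_wedgeOne_zero (θ : E →L[𝕜] 𝕜') (η : E [⋀^Fin 0]→L[𝕜] F) (w : E) :
    (wedgeOne θ η).curryLeft w = θ w • η := by
  ext v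
  rw [curryLeft_apply_apply, wedgeOne_apply, Fin.sum_univ_one]
  simp only [Fin.val_zero, pow_zero, one_smul, Matrix.cons_val_zero,
    ContinuousAlternatingMap.smul_apply]
  congr 1

/-- The symmetric bilinear operator `(x, y) ↦ (θ x · θ' y) • η` with values in `n`-forms, through
which `θ ∧ (θ' ∧ η)` factors. [folklore] -/
def smulBilin (θ θ' : E →L[𝕜] 𝕜') (η : E [⋀^Fin n]→L[𝕜] F) : E →L[𝕜] E →L[𝕜] E [⋀^Fin n]→L[𝕜] F :=
  (ContinuousLinearMap.compL 𝕜 E 𝕜' (E [⋀^Fin n]→L[𝕜] F)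
    ((ContinuousLinearMap.id 𝕜 𝕜').smulRight η)) ∘L
    ((ContinuousLinearMap.mul 𝕜 𝕜').bilinearComp θ θ')

/-- Unfolding of `smulBilin`. [folklore] -/
@[simp]
theorem smulBilin_apply (θ θ' : E →L[𝕜] 𝕜') (η : E [⋀^Fin n]→L[𝕜] F) (x y : E) :
    smulBilin θ θ' η x y = (θ x * θ' y) • η := by
  simp [smulBilin]

/-- `θ ∧ (θ' ∧ η)` is the double alternatization of `smulBilin θ θ' η`. [folklore] -/
theorem wedgeOne_wedgeOne_eq (θ θ' : E →L[𝕜] 𝕜') (η : E [⋀^Fin n]→L[𝕜] F) :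
    wedgeOne θ (wedgeOne θ' η) =
      alternatizeUncurryFin (alternatizeUncurryFinCLM 𝕜 E F ∘L smulBilin θ θ' η) := by
  simp only [wedgeOne]
  congr 1
  ext x v
  have hx : smulBilin θ θ' η x = θ x • θ'.smulRight η := by
    ext y w
    simp [mul_smul]
  simp [hx, alternatizeUncurryFin_smul]

/-- **Anticommutation of wedges with `1`-forms**: `θ ∧ (θ' ∧ η) + θ' ∧ (θ ∧ η) = 0`
(Warner (1983), 2.6: `θ ∧ θ' = -θ' ∧ θ` for `1`-forms), from the symmetry lemma behind
Mathlib's `extDeriv_extDeriv`. [cite: Warner1983, 2.6] -/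
theorem wedgeOne_wedgeOne_add_swap (θ θ' : E →L[𝕜] 𝕜') (η : E [⋀^Fin n]→L[𝕜] F) :
    wedgeOne θ (wedgeOne θ' η) + wedgeOne θ' (wedgeOne θ η) = 0 := by
  rw [wedgeOne_wedgeOne_eq, wedgeOne_wedgeOne_eq, ← alternatizeUncurryFin_add,
    ← ContinuousLinearMap.comp_add]
  apply alternatizeUncurryFin_alternatizeUncurryFinCLM_comp_of_symmetric
  intro x y
  ext v
  simp only [_root_.add_apply, smulBilin_apply, ContinuousAlternatingMap.add_apply,
    ContinuousAlternatingMap.smul_apply]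
  rw [add_comm, mul_comm (θ y), mul_comm (θ' y)]

/-- `θ ∧ (θ ∧ η) = 0`. [cite: Warner1983, 2.6] -/
theorem wedgeOne_wedgeOne_self (θ : E →L[𝕜] 𝕜') (η : E [⋀^Fin n]→L[𝕜] F) :
    wedgeOne θ (wedgeOne θ η) = 0 := by
  rw [wedgeOne_wedgeOne_eq]
  apply alternatizeUncurryFin_alternatizeUncurryFinCLM_comp_of_symmetric
  intro x y
  ext v
  simp only [smulBilin_apply, ContinuousAlternatingMap.smul_apply]
  rw [mul_comm]

/-- **Anticommutation of interior products**: `w' ⌟ (w ⌟ η) = -(w ⌟ (w' ⌟ η))`, i.e.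
`η(w, w', …) = -η(w', w, …)`. [folklore] -/
theorem curryLeft_curryLeft_swap (η : E [⋀^Fin (n + 2)]→L[𝕜] F) (w w' : E) :
    (η.curryLeft w).curryLeft w' = -(η.curryLeft w').curryLeft w := by
  ext v
  simp only [curryLeft_apply_apply, ContinuousAlternatingMap.neg_apply]
  rw [vecCons_vecCons_eq_comp_swap w w' v]
  exact η.toAlternatingMap.map_swap _ (by simp)

end Literature.LinearAlgebra.Alternating
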